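import Summits.AtomisticToContinuum.HydrodynamicLimit.Theses.BGEndpointRigidity
import Literature.Analysis.FluidPDE.HardSphereAlexander
import Literature.Analysis.FluidPDE.HardSphereRegularGeometry
import Literature.MathematicalPhysics.KineticTheory.HardSphereEulerProofs

/-!
Refutation of `BGEndpointRigidity.LanfordEnvelope` (item stmt-AtomisticToContinuum-11470)
[refuted-misstated].

The statement quantifies over ALL `Φ : HardSphereFlow …` and evaluates the transported density
`hsTransport Φ t W = W ∘ Φ.flow (-t)` at EVERY configuration, then takes `nthMarginal`, an
integral against full Lebesgue `volume` — not against the Liouville measure `volume|_{D_ε}`.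
But a `HardSphereFlow` only pins its flow map on the Liouville-conull `good ⊆ D_ε`; off `good`
(in particular on the OVERLAP set `{‖x₁ - x₂‖_{𝕋³} < ε}`, which is Liouville-null but has positive,
indeed infinite, Lebesgue measure) the values of `flow` are unconstrained junk.  Take the global
equilibrium profile `a₀ = θ₀ = 1, u₀ = 0`, two particles (`N = 1`), `s = N + 1 = 2`, `t = 0`, and
modify Alexander's flow `Φ₀` off its good set to the constant map onto a fixed non-overlapping,
zero-velocity configuration `z₀` (still a `HardSphereFlow`: every axiom only speaks about `good`
or holds Liouville-a.e.).  Then on the overlap set the "transported density" is the constant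
`W z₀ = 𝒵₂⁻¹ (2π)⁻³ > 0`, while the claimed envelope `C² e^{-β E(Z₂)}` tends to `0` as the kinetic
energy `E(Z₂) → ∞`; the set `{overlap} ∩ {E > E₀}` is open and non-empty, hence of positive
volume, contradicting the `∀ᵐ` bound.

Repair (C′, what the planner meant): measure the marginals of the transported density only on the
hard-sphere domain, e.g. replace `hsTransport Φ t (canonicalDensity …)` by
`(hardSphereDomain G ε (N+1)).indicator (hsTransport Φ t (canonicalDensity …))`
(equivalently: marginals of the Radon–Nikodym density of `Φ.lawAt (localGibbsLaw …) t` w.r.t.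
`volume`).  The witness below does NOT bite C′ (junk then lives on a volume-null set), so the item
is misstated, not substantively false.
-/

namespace Summit.AtomisticToContinuum.HydrodynamicLimit.Theorems

open MeasureTheory Set Filter
open Literature.Analysis.FluidPDE Literature.MathematicalPhysics.KineticTheory

/-- **Record of the replaced/dropped route item `LanfordEnvelope`** = stmt-AtomisticToContinuum-11470
(ledger signature verbatim; NOT a route item): after the theorem
`BGEndpointRigidityLanfordEnvelope_refuted` below closed the item `refuted` (see ledger), the route
repair removed the constant from the gate-written `Theses/BGEndpointRigidity.lean`, while the
refutation — append-only statement text — still names it ("Unknown identifier" in the full builds of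
2026-08-16). Re-declared here under its original fully-qualified name and definiens solely so that
the refutation record keeps elaborating. FALSE (see below). -/
def _root_.Summit.AtomisticToContinuum.HydrodynamicLimit.Theses.BGEndpointRigidity.LanfordEnvelope : Prop :=
  ∀ (a₀ θ₀ : Literature.MathematicalPhysics.KineticTheory.T3 → ℝ) (u₀ : Literature.MathematicalPhysics.KineticTheory.T3 → Literature.MathematicalPhysics.KineticTheory.V3), Continuous a₀ → Continuous θ₀ → Continuous u₀ → (∀ x, 0 < a₀ x) → (∀ x, 0 < θ₀ x) → ∃ σ₀ : ℝ, 0 < σ₀ ∧ ∀ σ : ℝ, 0 < σ → σ < σ₀ → ∀ T : ℝ, 0 < T → ∃ β C : ℝ, 0 < β ∧ ∀ (N : ℕ) (Φ : Literature.Analysis.FluidPDE.HardSphereFlow (Literature.Analysis.FluidPDE.Torus.geometry (Fin 3)) (Literature.MathematicalPhysics.KineticTheory.hsDiameter σ N) (N + 1)) (s : ℕ), ∀ t ∈ Set.Icc 0 T, ∀ᵐ Zs : Literature.Analysis.FluidPDE.Config s (Fin 3) Literature.MathematicalPhysics.KineticTheory.T3, |Literature.Analysis.FluidPDE.nthMarginal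 (N + 1) s (Literature.Analysis.FluidPDE.hsTransport Φ t (Literature.Analysis.FluidPDE.canonicalDensity (Literature.Analysis.FluidPDE.Torus.geometry (Fin 3)) (Literature.MathematicalPhysics.KineticTheory.hsDiameter σ N) (N + 1) (Literature.MathematicalPhysics.KineticTheory.localGibbsProfile a₀ u₀ θ₀))) Zs| ≤ C ^ s * Real.exp (-(β * Literature.Analysis.FluidPDE.configEnergy Zs))

section Marginal

variable {d : Type*} [Fintype d] {X : Type*} [MeasureSpace X] {N : ℕ}

/-- The top marginal is the function itself: `nthMarginal N N ρ = ρ`. [folklore] -/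
private theorem nthMarginal_self_apply_aux (ρ : Config N d X → ℝ) (z : Config N d X) :
    nthMarginal N N ρ z = ρ z := by
  rw [nthMarginal_of_le le_rfl]
  haveI : IsEmpty (Fin (N - N)) := ⟨fun i => absurd i.2 (by omega)⟩
  haveI : IsProbabilityMeasure (volume : Measure (Config (N - N) d X)) :=
    ⟨by rw [volume_pi, Measure.pi_empty_univ]⟩
  have hconst : ∀ zm : Config (N - N) d X,
      (ρ fun i => Fin.append z zm (Fin.cast (Nat.add_sub_of_le (le_refl N)).symm i)) = ρ z := by
    intro zm
    congr 1
    funext i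
    have hi : Fin.cast (Nat.add_sub_of_le (le_refl N)).symm i = Fin.castAdd (N - N) i :=
      Fin.ext rfl
    rw [hi, Fin.append_left]
  simp only [marginal, hconst, integral_const, smul_eq_mul, probReal_univ, one_mul]

end Marginal

/-- The local Gibbs profile data of the witness: global equilibrium `a₀ = θ₀ = 1`, `u₀ = 0`. -/
private theorem canonicalDensity_equilibrium_pos {σ : ℝ} (hσ2 : σ ≤ 1 / 2) {N : ℕ}
    {z₀ : Config (N + 1) (Fin 3) T3}
    (hz₀ : z₀ ∈ hardSphereDomain (Torus.geometry (Fin 3)) (N + 1) (hsDiameter σ N)) :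
    0 < canonicalDensity (Torus.geometry (Fin 3)) (hsDiameter σ N) (N + 1)
      (localGibbsProfile (fun _ => 1) (fun _ => 0) (fun _ => 1)) z₀ := by
  have hZpos : 0 < canonicalPartition (Torus.geometry (Fin 3)) (hsDiameter σ N) (N + 1)
      (localGibbsProfile (fun _ => 1) (fun _ => 0) (fun _ => 1)) := by
    rw [canonicalPartition_eq_posPartition (a₀ := fun _ => (1 : ℝ)) (θ₀ := fun _ => (1 : ℝ))
      (u₀ := fun _ => (0 : V3)) continuous_const continuous_const continuous_const
      (fun _ => zero_le_one) (fun _ => one_pos)]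
    exact posPartition_pos (a₀ := fun _ => (1 : ℝ)) continuous_const (fun _ => one_pos) hσ2 N
  rw [canonicalDensity, indicator_of_mem hz₀]
  refine mul_pos (inv_pos.2 hZpos) (Finset.prod_pos fun i _ => ?_)
  rw [localGibbsProfile, one_mul]
  exact localMaxwellian_pos one_pos one_pos _ _

set_option synthInstance.maxSize 1024 in
/-- Refutes `BGEndpointRigidity.LanfordEnvelope` [refuted-misstated]: the statement integrates the
junk values of `Φ.flow` off the good set (overlap configurations, Liouville-null but of positive
Lebesgue measure); witness: equilibrium profile `(1, 0, 1)`, two particles, `s = 2`, `t = 0`,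
Alexander's flow made constant `= z₀` (non-overlapping, zero velocities) off its good set — the
"marginal" is the constant `W z₀ > 0` on the overlap set while `C² e^{-βE} → 0`; repaired statement:
multiply the transported density by the indicator of `hardSphereDomain` (witness then misses).
[folklore] -/
theorem BGEndpointRigidityLanfordEnvelope_refuted :
    ¬ Summit.AtomisticToContinuum.HydrodynamicLimit.Theses.BGEndpointRigidity.LanfordEnvelope := by
  intro h
  obtain ⟨σ₀, hσ₀, h1⟩ := h (fun _ => 1) (fun _ => 1) (fun _ => 0) continuous_const
    continuous_const continuous_const (fun _ => one_pos) (fun _ => one_pos)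
  obtain ⟨σ, hσpos, hσlt, hσ4⟩ : ∃ σ : ℝ, 0 < σ ∧ σ < σ₀ ∧ σ ≤ 1 / 4 :=
    ⟨min (σ₀ / 2) (1 / 4), lt_min (by linarith) (by norm_num),
      lt_of_le_of_lt (min_le_left _ _) (by linarith), min_le_right _ _⟩
  have hσ2 : σ ≤ 1 / 2 := by linarith
  obtain ⟨β, C, hβ, h2⟩ := h1 σ hσpos hσlt 1 one_pos
  -- two particles: `N = 1`
  have hεpos : 0 < hsDiameter σ 1 := hsDiameter_pos hσpos 1
  have hεlt : hsDiameter σ 1 < 2⁻¹ := by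
    have := hsDiameter_le hσpos.le 1
    linarith
  obtain ⟨Φ₀⟩ := HardSphereFlow.nonempty_torus_holds (d := Fin 3) hεpos hεlt (1 + 1)
  obtain ⟨x₀, hx₀⟩ := exists_config_hsDiameter_lt hσ2 1
  obtain ⟨z₀, hz₀⟩ : ∃ z₀ : Config (1 + 1) (Fin 3) T3, z₀ = fun i => (x₀ i, 0) := ⟨_, rfl⟩
  have hz₀dom : z₀ ∈ hardSphereDomain (Torus.geometry (Fin 3)) (1 + 1) (hsDiameter σ 1) := by
    rw [mem_hardSphereDomain, hz₀]
    intro i j hij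
    exact (hx₀ i j hij).le
  have hw₀pos := canonicalDensity_equilibrium_pos hσ2 hz₀dom
  -- the junk-modified flow: Alexander's flow on its good set, the constant `z₀` off it
  obtain ⟨jm, hjm⟩ : ∃ jm : ℝ → Config (1 + 1) (Fin 3) T3 → Config (1 + 1) (Fin 3) T3,
      jm = fun t z => @ite _ (z ∈ Φ₀.good) (Classical.propDecidable _) (Φ₀.flow t z) z₀ :=
    ⟨_, rfl⟩
  have hjm_mem : ∀ t z, z ∈ Φ₀.good → jm t z = Φ₀.flow t z := fun t z hz => by
    rw [hjm]; exact if_pos hz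
  have hjm_not : ∀ t z, z ∉ Φ₀.good → jm t z = z₀ := fun t z hz => by
    rw [hjm]; exact if_neg hz
  have hjm_meas : ∀ t, Measurable (jm t) := fun t => by
    rw [hjm]; exact Measurable.ite Φ₀.measurableSet_good (Φ₀.measurable_flow t) measurable_const
  have hjm_ae : ∀ t, jm t =ᵐ[liouville (Torus.geometry (Fin 3)) (1 + 1) (hsDiameter σ 1)]
      Φ₀.flow t := fun t => by
    filter_upwards [Φ₀.ae_mem_good] with z hz
    exact hjm_mem t z hz
  obtain ⟨Φ, hΦ⟩ : ∃ Φ : HardSphereFlow (Torus.geometry (Fin 3)) (hsDiameter σ 1) (1 + 1),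
      Φ.flow = jm :=
    ⟨{ flow := jm
       good := Φ₀.good
       measurableSet_good := Φ₀.measurableSet_good
       good_subset := Φ₀.good_subset
       measure_compl_good := Φ₀.measure_compl_good
       mapsTo_good := fun t z hz => by
         rw [hjm_mem t z hz]
         exact Φ₀.mapsTo_good t hz
       flow_zero := fun z hz => by
         rw [hjm_mem 0 z hz]
         exact Φ₀.flow_zero z hz
       flow_add := fun s t z hz => by
         rw [hjm_mem _ z hz, hjm_mem t z hz, hjm_mem s _ (Φ₀.mapsTo_good t hz)]
         exact Φ₀.flow_add s t z hz
       measurable_flow := hjm_meas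
       isTrajectory := fun z hz => by
         have hfun : (fun t => jm t z) = fun t => Φ₀.flow t z := funext fun t => hjm_mem t z hz
         rw [hfun]
         exact Φ₀.isTrajectory z hz
       measurePreserving := fun t =>
         ⟨hjm_meas t, by rw [Measure.map_congr (hjm_ae t)]; exact (Φ₀.measurePreserving t).map_eq⟩ },
      rfl⟩
  have h3 := h2 1 Φ (1 + 1) 0 (left_mem_Icc.2 zero_le_one)
  -- the envelope tends to zero with the energy
  have htend : Tendsto (fun E : ℝ => C ^ (1 + 1) * Real.exp (-(β * E))) atTop (nhds 0) := by
    have hlin : Tendsto (fun E : ℝ => -(β * E)) atTop atBot :=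
      tendsto_neg_atTop_atBot.comp (Tendsto.const_mul_atTop hβ tendsto_id)
    have := (Real.tendsto_exp_atBot.comp hlin).const_mul (C ^ (1 + 1))
    simpa using this
  obtain ⟨E₀, hE₀⟩ := eventually_atTop.1 (htend.eventually (gt_mem_nhds hw₀pos))
  -- the bad set: overlapping positions, large energy
  obtain ⟨B, hB⟩ : ∃ B : Set (Config (1 + 1) (Fin 3) T3), B =
      {Zs | Torus.euclidDist (Zs 0).1 (Zs 1).1 < hsDiameter σ 1 ∧ E₀ < configEnergy Zs} := ⟨_, rfl⟩
  have hcontE : Continuous (configEnergy : Config (1 + 1) (Fin 3) T3 → ℝ) := by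
    unfold configEnergy
    fun_prop
  have hpair : Continuous fun Zs : Config (1 + 1) (Fin 3) T3 => ((Zs 0).1, (Zs 1).1) := by
    fun_prop
  have hcontD : Continuous fun Zs : Config (1 + 1) (Fin 3) T3 =>
      Torus.euclidDist (Zs 0).1 (Zs 1).1 := by
    simpa only [Function.comp_def] using Torus.continuous_euclidDist.comp hpair
  have hBopen : IsOpen B := by
    rw [hB]
    exact (isOpen_lt hcontD continuous_const).inter (isOpen_lt continuous_const hcontE)
  have hE₀' : E₀ ≤ max E₀ 0 := le_max_left _ _
  have hM0 : 0 ≤ max E₀ 0 := le_max_right _ _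
  have hBne : B.Nonempty := by
    rw [hB]
    refine ⟨fun _ => ((0 : T3), EuclideanSpace.single (0 : Fin 3) (max E₀ 0 + 1)), ?_, ?_⟩
    · simpa using hεpos
    · show E₀ < 2⁻¹ * ∑ _i : Fin (1 + 1), ‖EuclideanSpace.single (0 : Fin 3) (max E₀ 0 + 1)‖ ^ 2
      rw [PiLp.norm_single, Real.norm_eq_abs, abs_of_nonneg (by linarith)]
      simp only [Finset.sum_const, Finset.card_univ, Fintype.card_fin, nsmul_eq_mul]
      push_cast
      nlinarith
  have hBpos : 0 < volume B := hBopen.measure_pos volume hBne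
  -- on `B` the claimed bound fails: the "marginal" there is the constant junk value `W z₀`
  have hsub : B ⊆ {Zs | ¬ (|nthMarginal (1 + 1) (1 + 1) (hsTransport Φ 0
      (canonicalDensity (Torus.geometry (Fin 3)) (hsDiameter σ 1) (1 + 1)
        (localGibbsProfile (fun _ => 1) (fun _ => 0) (fun _ => 1)))) Zs| ≤
      C ^ (1 + 1) * Real.exp (-(β * configEnergy Zs)))} := by
    rw [hB]
    intro Zs hZs
    have hnot : Zs ∉ Φ₀.good := by
      intro hg
      have hdom := Φ₀.good_subset hg
      rw [mem_hardSphereDomain] at hdom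
      have h01 := hdom 0 1 (by decide)
      rw [Torus.norm_geometry_sepVec] at h01
      exact absurd hZs.1 (not_lt.2 h01)
    rw [mem_setOf_eq, nthMarginal_self_apply_aux, hsTransport_apply, hΦ, hjm_not _ _ hnot,
      abs_of_pos hw₀pos, not_le]
    exact hE₀ _ hZs.2.le
  exact hBpos.ne' (measure_mono_null hsub (ae_iff.1 h3))

end Summit.AtomisticToContinuum.HydrodynamicLimit.Theorems
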